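import Literature.AlgebraicGeometry.Motives.HodgeClassesBoundedNormFinite
import Literature.AlgebraicGeometry.Motives.HodgeStructurePeriodDomainOpen
import Literature.LinearAlgebra.BaseChange.SubmoduleBaseChangeLattice
import Mathlib.Topology.Algebra.Module.FiniteDimension
import Mathlib.Analysis.InnerProductSpace.Basic
import HarnessLib

/-!
# A lattice is discrete for the Hodge norm: integral vectors have norm bounded below, and only finitely many have
# bounded norm — also through any injective `ℂ`-linear map and modulo a rational subspace
# (the lattice half of Cattani–Deligne–Kaplan, Thm. 2.5 (i) / proof of Prop. 4.3)

Topic `Literature/AlgebraicGeometry/Motives` (namespace `…Motives.HodgeStructure.Polarization`).  Theorems only; no definition,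
no instance, no named fact (D-0026 net debt `0`).

PRINTED SOURCE, VERBATIM. E. Cattani, P. Deligne, A. Kaplan, *On the locus of Hodge classes*, J. Amer. Math. Soc. 8 (1995),
proof of **Prop. 4.3** (p. 503): «Fix a rational decomposition `V = ⊕ A^l` as in (3.7.1). The projection of `V_ℤ` in `A^l` is a
lattice. By (3.9.1), it follows that if `u(n)` has a nonzero projection in `A^a`, then `‖v(n)‖² ≫ τ₁(n)^{a₁}⋯τ_d(n)^{a_d}`.»;
**4.6** (p. 503): «`u(n)¹` is bounded. Being in a lattice, it can take only a finite number of values.»; **4.9** (p. 505):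
«Being bounded and integral, `u(n)` can take only finitely many values.»  (Thm. 2.5 (i): «There are only finitely many
`v ∈ V_ℤ` such that …».)

THE TREE'S SETTING. An integral structure is a finitely generated subgroup `Λ ⊆ V` of a finite-dimensional `ℚ`-space (as in
the tree's `HodgeStructure.Polarization.finite_mem_hodgeClasses_form_le`); norms on `V_ℂ = ℂ ⊗ V` are Hodge norms `‖·‖_h`
of polarized Hodge structures (`Polarization.hodgeNorm`, a genuine norm: `hodgeNormedAddCommGroup`).  «The projection of `V_ℤ`
in `A^l` is a lattice» becomes: for rational subspaces `A ≤ B ≤ V` and a `ℂ`-linear `f` on `V_ℂ` whose kernel on `B_ℂ` is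
`A_ℂ` (in the application: `A = W_{l−1}`, `B = W_l`, `f = π̂_l`), the values `f(1 ⊗ u)`, `u ∈ Λ ∩ B`, are discrete.

WHAT IS PROVED (finite dimension of the SOURCE space only; all constants ineffective):
* §1 **coordinates are bounded by the norm** (`exists_forall_abs_repr_le_hodgeNorm`): for an injective `ℂ`-linear
  `g : ℂ ⊗ U → V_ℂ` there is `C` with `|b.repr u i| ≤ C ‖g(1 ⊗ u)‖_h` for all `u ∈ U` (`b` the chosen `ℚ`-basis of `U`) —
  the inverse of `g` on its (finite-dimensional) range is continuous;
* §2 **discreteness** (`exists_pos_forall_le_hodgeNorm_of_fg`): for `Λ ⊆ U` finitely generated there is `c > 0` with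
  `‖g(1 ⊗ u)‖_h ≥ c` for all `0 ≠ u ∈ Λ` (bounded denominators, the tree's `exists_den_of_fg`); **finiteness**
  (`finite_setOf_mem_hodgeNorm_le_of_fg`): `{u ∈ Λ : ‖g(1 ⊗ u)‖_h ≤ R}` is finite;
* §3 the case `g = id`: `‖1 ⊗ u‖_h ≥ c` on `Λ ∖ 0`, finitely many `u ∈ Λ` with `‖1 ⊗ u‖_h ≤ R`;
* §4 **modulo a rational subspace** (`exists_pos_forall_le_hodgeNorm_apply_of_fg`, `finite_image_hodgeNorm_apply_le_of_fg`): for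
  rational subspaces `A, B` of `V` and `f : V_ℂ → V_ℂ` with `A_ℂ ⊆ ker f` and `B_ℂ ∩ ker f ⊆ A_ℂ`, there is `c > 0` with `‖f(1 ⊗ u)‖_h ≥ c`
  for all `u ∈ Λ ∩ B` with `f(1 ⊗ u) ≠ 0`, and the set of values `{f(1 ⊗ u) : u ∈ Λ ∩ B, ‖f(1 ⊗ u)‖_h ≤ R}` is finite
  (a rational complement `C` of `A` in `B` reduces to §2 for `g = f ∘ (ℂ ⊗ C ↪ V_ℂ)`, injective).

## References

* [CattaniDeligneKaplan1995] E. Cattani, P. Deligne, A. Kaplan, *On the locus of Hodge classes*, J. Amer. Math. Soc. 8 (1995)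
  483–506: Thm. 2.5 (i) (p. 488), (3.7.1) and (3.9.1) (p. 498), proof of Prop. 4.3, 4.6, 4.9 (pp. 503–505).
* [CarlsonMullerStachPeters2017] J. Carlson, S. Müller-Stach, C. Peters, *Period Mappings and Period Domains*, 2nd ed. (2017):
  §2.3 Thm. 2.3.3 and eq. (2.6) (the Hodge norm).
* [Schmid1973] W. Schmid, Invent. Math. 22 (1973): §2 (flat integral structure) (cite only).
-/

noncomputable section

open scoped TensorProduct

namespace Literature.AlgebraicGeometry.Motives

open Module

universe u v

variable {V : Type u} [AddCommGroup V] [Module ℚ V] {n : ℤ}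

namespace HodgeStructure.Polarization

variable {H : HodgeStructure V n} (P : H.Polarization)
variable {U : Type v} [AddCommGroup U] [Module ℚ U] [FiniteDimensional ℚ U]

/-! ## §1 Rational coordinates are bounded by the Hodge norm of the image -/

omit [FiniteDimensional ℚ U] in
/-- `(1 ⊗ ·)` in the coordinates of the base-changed basis: the coordinate vector of `1 ⊗ u` with respect to the `ℂ`-basis
`1 ⊗ b_i` of `ℂ ⊗ U` is the rational coordinate vector of `u`. [folklore] -/
private theorem basis_equivFun_one_tmul (b : Basis (Fin (finrank ℚ U)) ℚ U) (u : U) :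
    (Algebra.TensorProduct.basis ℂ b).equivFun ((1 : ℂ) ⊗ₜ[ℚ] u) = fun i => ((b.repr u i : ℚ) : ℂ) := by
  ext i
  rw [Module.Basis.equivFun_apply, Algebra.TensorProduct.basis_repr_tmul, one_smul, Finsupp.mapRange_apply, eq_ratCast]

/-- **Rational coordinates are bounded by the Hodge norm**: for an injective `ℂ`-linear map `g : ℂ ⊗ U → V_ℂ` (`U` a
finite-dimensional `ℚ`-space with its chosen basis `b`) there is `C > 0` with `|b.repr u i| ≤ C · ‖g(1 ⊗ u)‖_h` for all `u ∈ U` and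
all `i` — the inverse of `g` on its finite-dimensional range is bounded («for a fixed norm on `V`», CDK 2.13).
[cite: CattaniDeligneKaplan1995, proof of Prop. 4.3 (p. 503) and 2.13 (p. 491)] [cite: CarlsonMullerStachPeters2017, §2.3 Thm. 2.3.3] -/
theorem exists_forall_abs_repr_le_hodgeNorm (g : ℂ ⊗[ℚ] U →ₗ[ℂ] ℂ ⊗[ℚ] V) (hg : Function.Injective g) :
    ∃ C : ℝ, 0 < C ∧ ∀ (u : U) (i : Fin (finrank ℚ U)),
      |((Module.finBasis ℚ U).repr u i : ℝ)| ≤ C * P.hodgeNorm (g ((1 : ℂ) ⊗ₜ[ℚ] u)) := by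
  letI := P.hodgeNormedAddCommGroup
  letI := P.hodgeInnerProductSpace
  set b := Module.finBasis ℚ U
  set bC := Algebra.TensorProduct.basis ℂ b with hbC
  let T : (Fin (finrank ℚ U) → ℂ) →ₗ[ℂ] ℂ ⊗[ℚ] V := g ∘ₗ bC.equivFun.symm.toLinearMap
  have hT : Function.Injective T := hg.comp bC.equivFun.symm.injective
  let e := LinearEquiv.ofInjective T hT
  let S : LinearMap.range T →L[ℂ] (Fin (finrank ℚ U) → ℂ) := LinearMap.toContinuousLinearMap e.symm.toLinearMap
  refine ⟨‖S‖ + 1, by positivity, fun u i => ?_⟩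
  set c : Fin (finrank ℚ U) → ℂ := fun i => ((b.repr u i : ℚ) : ℂ) with hc
  have hTc : T c = g ((1 : ℂ) ⊗ₜ[ℚ] u) := by
    show g (bC.equivFun.symm c) = g ((1 : ℂ) ⊗ₜ[ℚ] u)
    rw [hc, ← basis_equivFun_one_tmul b u, LinearEquiv.symm_apply_apply]
  have hec : e c = ⟨T c, LinearMap.mem_range_self T c⟩ := Subtype.ext (LinearEquiv.ofInjective_apply T c)
  have h1 : c = S ⟨T c, LinearMap.mem_range_self T c⟩ := by
    show c = e.symm ⟨T c, LinearMap.mem_range_self T c⟩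
    rw [← hec, LinearEquiv.symm_apply_apply]
  have h2 : ‖c‖ ≤ ‖S‖ * ‖T c‖ := by
    have h := S.le_opNorm ⟨T c, LinearMap.mem_range_self T c⟩
    rwa [← h1] at h
  have h3 : |((b.repr u i : ℚ) : ℝ)| = ‖c i‖ := by rw [hc]; exact (Complex.norm_ratCast _).symm
  have h4 : ‖c i‖ ≤ ‖c‖ := norm_le_pi_norm c i
  have h5 : ‖T c‖ = P.hodgeNorm (g ((1 : ℂ) ⊗ₜ[ℚ] u)) := by rw [hTc]; rfl
  rw [h3]
  calc ‖c i‖ ≤ ‖S‖ * ‖T c‖ := h4.trans h2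
    _ ≤ (‖S‖ + 1) * ‖T c‖ := mul_le_mul_of_nonneg_right (le_add_of_nonneg_right zero_le_one) (norm_nonneg _)
    _ = (‖S‖ + 1) * P.hodgeNorm (g ((1 : ℂ) ⊗ₜ[ℚ] u)) := by rw [h5]

/-! ## §2 A finitely generated subgroup is discrete and has finitely many vectors of bounded norm -/

/-- **Bounded denominators in coordinates**: for `Λ ⊆ U` finitely generated there is `D ≥ 1` with `D · b.repr u i ∈ ℤ` for all
`u ∈ Λ` (the tree's `exists_den_of_fg` on the coordinate image of `Λ`). [cite: CattaniDeligneKaplan1995, proof of Prop. 4.3 (p. 503)] -/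
theorem exists_den_repr_of_fg (Λ : Submodule ℤ U) (hΛ : Λ.FG) :
    ∃ D : ℕ, 0 < D ∧ ∀ u ∈ Λ, ∀ i : Fin (finrank ℚ U), ∃ z : ℤ, (D : ℚ) * (Module.finBasis ℚ U).repr u i = z := by
  set b := Module.finBasis ℚ U
  obtain ⟨D, hD, h⟩ := exists_den_of_fg (Λ.map (b.equivFun.toLinearMap.restrictScalars ℤ)) (hΛ.map _)
  refine ⟨D, hD, fun u hu i => ?_⟩
  have hmem : b.equivFun u ∈ Λ.map (b.equivFun.toLinearMap.restrictScalars ℤ) := ⟨u, hu, rfl⟩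
  obtain ⟨z, hz⟩ := h _ hmem i
  exact ⟨z, by rw [← hz, Module.Basis.equivFun_apply]⟩

/-- **Discreteness: a finitely generated subgroup stays away from `0` in the Hodge norm, through any injective `ℂ`-linear map**:
for `g : ℂ ⊗ U → V_ℂ` injective and `Λ ⊆ U` finitely generated there is `c > 0` with `‖g(1 ⊗ u)‖_h ≥ c` for every `0 ≠ u ∈ Λ`
(some coordinate of `u` is a nonzero element of `D⁻¹ℤ`). «The projection of `V_ℤ` in `A^l` is a lattice.»
[cite: CattaniDeligneKaplan1995, proof of Prop. 4.3 (p. 503)] [cite: CarlsonMullerStachPeters2017, §2.3 Thm. 2.3.3] -/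
theorem exists_pos_forall_le_hodgeNorm_of_fg (g : ℂ ⊗[ℚ] U →ₗ[ℂ] ℂ ⊗[ℚ] V) (hg : Function.Injective g)
    (Λ : Submodule ℤ U) (hΛ : Λ.FG) :
    ∃ c : ℝ, 0 < c ∧ ∀ u ∈ Λ, u ≠ 0 → c ≤ P.hodgeNorm (g ((1 : ℂ) ⊗ₜ[ℚ] u)) := by
  set b := Module.finBasis ℚ U
  obtain ⟨C, hC, hcoord⟩ := P.exists_forall_abs_repr_le_hodgeNorm g hg
  obtain ⟨D, hD, hden⟩ := exists_den_repr_of_fg Λ hΛ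
  have hD' : (0 : ℝ) < D := by exact_mod_cast hD
  refine ⟨(C * D)⁻¹, by positivity, fun u hu hu0 => ?_⟩
  -- some coordinate of `u` is nonzero, hence `≥ 1/D` in absolute value
  obtain ⟨i, hi⟩ : ∃ i, b.repr u i ≠ 0 := by
    by_contra h
    simp only [not_exists, not_not] at h
    exact hu0 (b.repr.injective (Finsupp.ext fun i => by rw [h i, map_zero, Finsupp.zero_apply]))
  obtain ⟨z, hz⟩ := hden u hu i
  have hz0 : z ≠ 0 := by
    rintro rfl
    rw [Int.cast_zero, mul_eq_zero] at hz
    exact hz.elim (fun h => hD.ne' (by exact_mod_cast h)) hi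
  have hzabs : (1 : ℝ) ≤ |(z : ℝ)| := by exact_mod_cast Int.one_le_abs hz0
  have hrepr : (1 : ℝ) ≤ D * |((b.repr u i : ℚ) : ℝ)| := by
    have h : ((D : ℚ) * b.repr u i : ℚ) = (z : ℚ) := hz
    have h' : (D : ℝ) * ((b.repr u i : ℚ) : ℝ) = (z : ℝ) := by exact_mod_cast h
    rw [← abs_of_pos hD', ← abs_mul, h']
    exact hzabs
  have hle := hcoord u i
  rw [inv_le_iff_one_le_mul₀ (by positivity)]
  calc (1 : ℝ) ≤ D * |((b.repr u i : ℚ) : ℝ)| := hrepr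
    _ ≤ D * (C * P.hodgeNorm (g ((1 : ℂ) ⊗ₜ[ℚ] u))) := mul_le_mul_of_nonneg_left hle hD'.le
    _ = P.hodgeNorm (g ((1 : ℂ) ⊗ₜ[ℚ] u)) * (C * D) := by ring

/-- **Finiteness: only finitely many vectors of a finitely generated subgroup have bounded Hodge norm, through any injective
`ℂ`-linear map** — `{u ∈ Λ : ‖g(1 ⊗ u)‖_h ≤ R}` is finite (the coordinates `D · b.repr u i` are integers of absolute value
`≤ D C R`). «Being bounded and integral, `u(n)` can take only finitely many values.»
[cite: CattaniDeligneKaplan1995, 4.9 (p. 505) and Thm. 2.5 (i) (p. 488)] [cite: CarlsonMullerStachPeters2017, §2.3 Thm. 2.3.3] -/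
theorem finite_setOf_mem_hodgeNorm_le_of_fg (g : ℂ ⊗[ℚ] U →ₗ[ℂ] ℂ ⊗[ℚ] V) (hg : Function.Injective g)
    (Λ : Submodule ℤ U) (hΛ : Λ.FG) (R : ℝ) :
    {u : U | u ∈ Λ ∧ P.hodgeNorm (g ((1 : ℂ) ⊗ₜ[ℚ] u)) ≤ R}.Finite := by
  set b := Module.finBasis ℚ U
  obtain ⟨C, hC, hcoord⟩ := P.exists_forall_abs_repr_le_hodgeNorm g hg
  obtain ⟨D, hD, hden⟩ := exists_den_repr_of_fg Λ hΛ
  -- the finite box of integer coordinate vectors `|z_i| ≤ ⌈D C R⌉`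
  let B : ℤ := ⌈(D : ℝ) * C * R⌉
  have hbox : (Set.univ.pi fun _ : Fin (finrank ℚ U) => Set.Icc (-B) B).Finite := Set.Finite.pi fun _ => Set.finite_Icc _ _
  refine (hbox.image fun z : Fin (finrank ℚ U) → ℤ => b.equivFun.symm fun i => (z i : ℚ) / D).subset ?_
  rintro u ⟨hu, huR⟩
  choose z hz using hden u hu
  refine ⟨z, fun i _ => ?_, ?_⟩
  · have hD' : (0 : ℝ) < D := by exact_mod_cast hD
    have h' : (D : ℝ) * ((b.repr u i : ℚ) : ℝ) = (z i : ℝ) := by exact_mod_cast hz i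
    have habs : |(z i : ℝ)| ≤ (D : ℝ) * C * R := by
      rw [← h', abs_mul, abs_of_pos hD', mul_assoc]
      exact mul_le_mul_of_nonneg_left ((hcoord u i).trans (mul_le_mul_of_nonneg_left huR hC.le)) hD'.le
    have hB : |z i| ≤ B := Int.cast_le.1 ((Int.cast_abs (R := ℝ)).symm ▸ habs.trans (Int.le_ceil _))
    exact Set.mem_Icc.2 (abs_le.1 hB)
  · have hD' : (D : ℚ) ≠ 0 := by exact_mod_cast hD.ne'
    apply b.equivFun.injective
    rw [LinearEquiv.apply_symm_apply]
    funext i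
    rw [Module.Basis.equivFun_apply, ← hz i, mul_div_cancel_left₀ _ hD']

/-! ## §3 The lattice `1 ⊗ Λ ⊆ V_ℂ` itself -/

omit [FiniteDimensional ℚ U] in
/-- `1 ⊗ · : U → ℂ ⊗ U` followed by nothing: the identity of `ℂ ⊗ U` is injective. [folklore] -/
private theorem injective_id : Function.Injective (LinearMap.id : ℂ ⊗[ℚ] U →ₗ[ℂ] ℂ ⊗[ℚ] U) := fun _ _ h => h

/-- **A lattice is discrete for the Hodge norm**: for `Λ ⊆ V` finitely generated (`V` finite-dimensional) there is `c > 0` with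
`‖1 ⊗ u‖_h ≥ c` for all `0 ≠ u ∈ Λ`. [cite: CattaniDeligneKaplan1995, proof of Prop. 4.3 (p. 503)] [cite: CarlsonMullerStachPeters2017, §2.3 Thm. 2.3.3] -/
theorem exists_pos_forall_le_hodgeNorm_ofRat_of_fg [FiniteDimensional ℚ V] (Λ : Submodule ℤ V) (hΛ : Λ.FG) :
    ∃ c : ℝ, 0 < c ∧ ∀ u ∈ Λ, u ≠ 0 → c ≤ P.hodgeNorm (ofRat u) := by
  obtain ⟨c, hc, h⟩ := P.exists_pos_forall_le_hodgeNorm_of_fg LinearMap.id injective_id Λ hΛ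
  exact ⟨c, hc, fun u hu hu0 => by rw [ofRat_apply]; exact h u hu hu0⟩

/-- **Integral vectors of bounded Hodge norm are finite in number**: `{u ∈ Λ : ‖1 ⊗ u‖_h ≤ R}` is finite.
[cite: CattaniDeligneKaplan1995, Thm. 2.5 (i) (p. 488) and 4.9 (p. 505)] [cite: CarlsonMullerStachPeters2017, §2.3 Thm. 2.3.3] -/
theorem finite_setOf_mem_hodgeNorm_ofRat_le_of_fg [FiniteDimensional ℚ V] (Λ : Submodule ℤ V) (hΛ : Λ.FG) (R : ℝ) :
    {u : V | u ∈ Λ ∧ P.hodgeNorm (ofRat u) ≤ R}.Finite := by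
  have h := P.finite_setOf_mem_hodgeNorm_le_of_fg LinearMap.id injective_id Λ hΛ R
  refine h.subset fun u hu => ⟨hu.1, ?_⟩
  rw [LinearMap.id_apply, ← ofRat_apply]
  exact hu.2

/-! ## §4 Modulo a rational subspace: the values `f(1 ⊗ u)`, `u ∈ Λ ∩ B`, when `ker f ∩ B_ℂ = A_ℂ` -/

section Modulo

variable [FiniteDimensional ℚ V] {A B : Submodule ℚ V} (f : ℂ ⊗[ℚ] V →ₗ[ℂ] ℂ ⊗[ℚ] V)

omit [FiniteDimensional ℚ V] in
/-- The reduction, injectivity: for a rational subspace `C ≤ B` with `A ⊓ C = ⊥`, the map `f ∘ (ℂ ⊗ C ↪ V_ℂ)` is injective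
when `B_ℂ ∩ ker f ⊆ A_ℂ` (`A_ℂ ∩ C_ℂ = (A ∩ C)_ℂ = 0`, flatness). [folklore] -/
private theorem injective_comp_baseChange (C : Submodule ℚ V) (hCB : C ≤ B) (hAC : A ⊓ C = ⊥)
    (hker : ∀ x ∈ B.baseChange ℂ, f x = 0 → x ∈ A.baseChange ℂ) :
    Function.Injective (f ∘ₗ C.subtype.baseChange ℂ) := by
  rw [← LinearMap.ker_eq_bot, LinearMap.ker_eq_bot']
  intro x hx
  rw [LinearMap.comp_apply] at hx
  have hxC : C.subtype.baseChange ℂ x ∈ C.baseChange ℂ := ⟨x, rfl⟩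
  have hxA := hker _ (Submodule.baseChange_mono ℂ hCB hxC) hx
  have h0 : C.subtype.baseChange ℂ x ∈ A.baseChange ℂ ⊓ C.baseChange ℂ := ⟨hxA, hxC⟩
  rw [← Literature.LinearAlgebra.BaseChange.baseChange_inf, hAC, Submodule.baseChange_bot, Submodule.mem_bot] at h0
  exact MixedHodgeStructure.baseChange_injective C.injective_subtype (by rw [h0, map_zero])

/-- **Discreteness and finiteness modulo a rational subspace.** Let `A ≤ B` be rational subspaces of `V`, `f : V_ℂ → V_ℂ` a
`ℂ`-linear map with `A_ℂ ⊆ ker f` and `B_ℂ ∩ ker f ⊆ A_ℂ` (so `f|_{B_ℂ}` factors through an injection of `(B/A)_ℂ`), and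
`Λ ⊆ V` finitely generated.  Then there is `c > 0` with `‖f(1 ⊗ u)‖_h ≥ c` for all `u ∈ Λ ∩ B` with `f(1 ⊗ u) ≠ 0`, and for every
`R` the set of VALUES `{f(1 ⊗ u) : u ∈ Λ ∩ B, ‖f(1 ⊗ u)‖_h ≤ R}` is finite — «the projection of `V_ℤ` in `A^l` is a lattice»
(`A = W_{l−1}`, `B = W_l`, `f` the projection to the weight-`l` piece), «being in a lattice, it can take only a finite number of
values». (A rational complement `C` of `A` in `B` reduces to §2 for `g = f ∘ (ℂ ⊗ C ↪ V_ℂ)`.)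
[cite: CattaniDeligneKaplan1995, proof of Prop. 4.3 and 4.6 (p. 503), (3.7.1) (p. 498)] [cite: CarlsonMullerStachPeters2017, §2.3 Thm. 2.3.3] -/
theorem exists_pos_forall_le_hodgeNorm_apply_and_finite_of_fg (hkerA : ∀ x ∈ A.baseChange ℂ, f x = 0)
    (hker : ∀ x ∈ B.baseChange ℂ, f x = 0 → x ∈ A.baseChange ℂ) (Λ : Submodule ℤ V) (hΛ : Λ.FG) :
    (∃ c : ℝ, 0 < c ∧ ∀ u ∈ Λ, u ∈ B → f (ofRat u) ≠ 0 → c ≤ P.hodgeNorm (f (ofRat u))) ∧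
      ∀ R : ℝ, {x : ℂ ⊗[ℚ] V | ∃ u ∈ Λ, u ∈ B ∧ P.hodgeNorm (f (ofRat u)) ≤ R ∧ f (ofRat u) = x}.Finite := by
  -- a rational complement `C'` of `A ∩ B` inside `B`, and the projection `pr : B → C'` along `A ∩ B`
  obtain ⟨C', hC'⟩ := Submodule.exists_isCompl (A.comap B.subtype)
  let pr : B →ₗ[ℚ] C' := Submodule.projectionOnto C' (A.comap B.subtype) hC'.symm
  -- the injective map `g = f ∘ (ℂ ⊗ C' ↪ V_ℂ)`
  let ι : C' →ₗ[ℚ] V := B.subtype ∘ₗ C'.subtype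
  have hι : Function.Injective ι := B.injective_subtype.comp C'.injective_subtype
  set C : Submodule ℚ V := C'.map B.subtype with hC_def
  have hCB : C ≤ B := by
    rintro _ ⟨c, _, rfl⟩
    exact c.2
  have hAC : A ⊓ C = ⊥ := by
    rw [eq_bot_iff]
    rintro x ⟨hxA, ⟨c, hc, rfl⟩⟩
    have h : c ∈ A.comap B.subtype ⊓ C' := ⟨hxA, hc⟩
    rw [hC'.inf_eq_bot, Submodule.mem_bot] at h
    rw [h, map_zero]
    exact zero_mem _
  let g : ℂ ⊗[ℚ] C' →ₗ[ℂ] ℂ ⊗[ℚ] V := f ∘ₗ ι.baseChange ℂ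
  have hg : Function.Injective g := by
    -- `ι = C.subtype ∘ (C' ≃ C)`, and `f ∘ (ℂ ⊗ C ↪ V_ℂ)` is injective
    have hinj := injective_comp_baseChange f C hCB hAC hker
    intro x y hxy
    have hrange : ∀ z : ℂ ⊗[ℚ] C', ∃ w : ℂ ⊗[ℚ] C, C.subtype.baseChange ℂ w = ι.baseChange ℂ z := by
      intro z
      induction z using TensorProduct.induction_on with
      | zero => exact ⟨0, by rw [map_zero, map_zero]⟩
      | tmul a c => exact ⟨a ⊗ₜ ⟨ι c, ⟨c, c.2, rfl⟩⟩, by rw [LinearMap.baseChange_tmul, LinearMap.baseChange_tmul]; rfl⟩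
      | add z₁ z₂ h₁ h₂ =>
        obtain ⟨w₁, hw₁⟩ := h₁
        obtain ⟨w₂, hw₂⟩ := h₂
        exact ⟨w₁ + w₂, by rw [map_add, map_add, hw₁, hw₂]⟩
    obtain ⟨wx, hwx⟩ := hrange x
    obtain ⟨wy, hwy⟩ := hrange y
    have h1 : (f ∘ₗ C.subtype.baseChange ℂ) wx = (f ∘ₗ C.subtype.baseChange ℂ) wy := by
      rw [LinearMap.comp_apply, LinearMap.comp_apply, hwx, hwy]
      exact hxy
    have h2 : ι.baseChange ℂ x = ι.baseChange ℂ y := by rw [← hwx, ← hwy, hinj h1]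
    exact MixedHodgeStructure.baseChange_injective hι h2
  -- the `C'`-components of `Λ ∩ B`: a finitely generated subgroup of `C'`
  haveI : IsNoetherian ℤ Λ := isNoetherian_of_fg_of_noetherian _ hΛ
  let ΛB : Submodule ℤ B := Λ.comap (B.subtype.restrictScalars ℤ)
  have hΛB : ΛB.FG := by
    refine Submodule.fg_of_fg_map_injective (B.subtype.restrictScalars ℤ) B.injective_subtype ?_
    have hle : ΛB.map (B.subtype.restrictScalars ℤ) ≤ Λ := Submodule.map_comap_le _ _
    have h : ((ΛB.map (B.subtype.restrictScalars ℤ)).comap Λ.subtype).map Λ.subtype = ΛB.map (B.subtype.restrictScalars ℤ) := by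
      rw [Submodule.map_comap_subtype, inf_eq_right.2 hle]
    rw [← h]
    exact (IsNoetherian.noetherian _).map _
  let Λ' : Submodule ℤ C' := ΛB.map (pr.restrictScalars ℤ)
  have hΛ' : Λ'.FG := hΛB.map _
  -- for `u ∈ Λ ∩ B`: `f(1 ⊗ u) = g(1 ⊗ pr u)` with `pr u ∈ Λ'`
  have hval : ∀ u ∈ Λ, ∀ hu : u ∈ B, f (ofRat u) = g ((1 : ℂ) ⊗ₜ[ℚ] pr ⟨u, hu⟩) ∧ pr ⟨u, hu⟩ ∈ Λ' := by
    intro u huΛ hu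
    refine ⟨?_, ⟨⟨u, hu⟩, huΛ, rfl⟩⟩
    have hdec : (⟨u, hu⟩ : B) - ((pr ⟨u, hu⟩ : C') : B) ∈ A.comap B.subtype := by
      rw [← Submodule.ker_projectionOnto hC'.symm, LinearMap.mem_ker, map_sub,
        Submodule.projectionOnto_apply_left, sub_self]
    have ha : u - ι (pr ⟨u, hu⟩) ∈ A := hdec
    set w : V := ι (pr ⟨u, hu⟩) with hw
    show f (ofRat u) = f (ι.baseChange ℂ ((1 : ℂ) ⊗ₜ[ℚ] pr ⟨u, hu⟩))
    have hsplit : ofRat u = (1 : ℂ) ⊗ₜ[ℚ] (u - w) + (1 : ℂ) ⊗ₜ[ℚ] w := by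
      rw [ofRat_apply, ← TensorProduct.tmul_add, sub_add_cancel]
    rw [LinearMap.baseChange_tmul, hsplit, map_add, hkerA _ (Submodule.tmul_mem_baseChange_of_mem 1 ha), zero_add]
  refine ⟨?_, fun R => ?_⟩
  · obtain ⟨c, hc, h⟩ := P.exists_pos_forall_le_hodgeNorm_of_fg g hg Λ' hΛ'
    refine ⟨c, hc, fun u huΛ hu hne => ?_⟩
    obtain ⟨hfu, hmem⟩ := hval u huΛ hu
    rw [hfu] at hne ⊢
    exact h _ hmem fun h0 => hne (by rw [h0, TensorProduct.tmul_zero, map_zero])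
  · refine ((P.finite_setOf_mem_hodgeNorm_le_of_fg g hg Λ' hΛ' R).image fun c => g ((1 : ℂ) ⊗ₜ[ℚ] c)).subset ?_
    rintro x ⟨u, huΛ, hu, hR, rfl⟩
    obtain ⟨hfu, hmem⟩ := hval u huΛ hu
    exact ⟨pr ⟨u, hu⟩, ⟨hmem, hfu ▸ hR⟩, hfu.symm⟩

/-- **Discreteness modulo a rational subspace** (first half of the previous statement).
[cite: CattaniDeligneKaplan1995, proof of Prop. 4.3 (p. 503)] -/
theorem exists_pos_forall_le_hodgeNorm_apply_of_fg (hkerA : ∀ x ∈ A.baseChange ℂ, f x = 0)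
    (hker : ∀ x ∈ B.baseChange ℂ, f x = 0 → x ∈ A.baseChange ℂ) (Λ : Submodule ℤ V) (hΛ : Λ.FG) :
    ∃ c : ℝ, 0 < c ∧ ∀ u ∈ Λ, u ∈ B → f (ofRat u) ≠ 0 → c ≤ P.hodgeNorm (f (ofRat u)) :=
  (P.exists_pos_forall_le_hodgeNorm_apply_and_finite_of_fg f hkerA hker Λ hΛ).1

/-- **Finiteness of the values modulo a rational subspace** (second half): «being in a lattice, it can take only a finite number
of values». [cite: CattaniDeligneKaplan1995, 4.6 (p. 503)] -/
theorem finite_image_hodgeNorm_apply_le_of_fg (hkerA : ∀ x ∈ A.baseChange ℂ, f x = 0)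
    (hker : ∀ x ∈ B.baseChange ℂ, f x = 0 → x ∈ A.baseChange ℂ) (Λ : Submodule ℤ V) (hΛ : Λ.FG) (R : ℝ) :
    {x : ℂ ⊗[ℚ] V | ∃ u ∈ Λ, u ∈ B ∧ P.hodgeNorm (f (ofRat u)) ≤ R ∧ f (ofRat u) = x}.Finite :=
  (P.exists_pos_forall_le_hodgeNorm_apply_and_finite_of_fg f hkerA hker Λ hΛ).2 R

end Modulo

end HodgeStructure.Polarization

end Literature.AlgebraicGeometry.Motives

end
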